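import Summits.QuantumFields.BalabanUV.T4Continuum.Spine.NE3.LandauProjectionB8
import Summits.QuantumFields.BalabanUV.T4Continuum.Support.NE3CurlOfGaugeDir
import Summits.QuantumFields.BalabanUV.T4Continuum.Support.NE3CurlPairedResidualEnd
import HarnessLib

/-!
# T⁴ programme, node NE3 — REPAIR R24 (γ3): THE ℓ-LETTERS OF THE LANDAU CORRECTION `gaugeDir W λ` IN THE JUNCTION'S CURRENCY — `dirSq`, `curlSq`, `Σ‖curl‖`,
# `dirL1` of the correction against the covariant divergence of the field it corrects, k-FREE (the constants carry `card n` and the torus volume `N^d`)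

Cell `pub-balaban-gaps` (YM blitz, track G2, seat `ne3`, unit `pub-balaban-gaps-ne3`; writer prover-pub-balaban-gaps-ne3-g3-0, 2026-08-23), census
`run/shared/lean/pub/pub-balaban-gaps/ne/NE3.md` §4 R24 (γ3).  The supplier `Spine/NE3/SupplierB8.decomposedRepT_slicB8_of_landauRepB8Avg` takes the letters (R1)–(R4) of its Landau
linear normal part `Nn = Y + gaugeDir W λ` as hypotheses; for `Y` (the lift of the solved datum) they are `QbarRightInverseB8` ∕ `CovLiftCurlLettersB8`; THIS FILE gives them for
the CORRECTION `gaugeDir W λ` in terms of ONE quantity, `V := Σ_{y∈F} nhsNormSq (covDiv_W Y y)` over the period box `F` — through `Spine/NE3/LandauProjectionB8.sum_nhsNormSq_gaugeDir_le_of_isLandauB8`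
(`Σ nhsNormSq (gaugeDir W λ) ≤ 4M²V`), K6-Ξ's Poincaré (`Σ nhsNormSq λ ≤ 4M²·Σ nhsNormSq (gaugeDir W λ)`), `MatrixNorms.opNorm_sq_le_card_mul_nhsNormSq`, the pure-gauge curl
`NE3CurlOfGaugeDir.curlSq_gaugeDir_le` ∕ `norm_curlAt_gaugeDir_le` (`‖curl_W (gaugeDir W ζ)(x;μ,ν)‖ ≤ 2x_W‖ζ x‖`) and Cauchy–Schwarz
(`NE3CurlPairedResidualEnd.dirL1_le_sqrt_mul_sqrt_dirSq`); `CovLiftDivergenceB8.sum_nhsNormSq_covDiv_covLift_le` then makes `V = O(M^{d−4})·dirSq Φ`.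

CONTENT ([folklore]; 0 sorry; no `def`; `M = L^{j+1}`, `F = periodBox (N·M)`): §1 `sum_normSq_gaugeDir_le` (`dirSq (gaugeDir W λ) F ≤ card n·4M²·V` — (R1) of the correction),
`sum_normSq_le_of_correction` (`Σ_y ‖λ y‖² ≤ card n·16M⁴·V`), `curlSq_gaugeDir_le_of_correction` (`curlSq ≤ 4x²·card(Plane)·card n·16M⁴·V` — (R2); `O(V)` in the regime `M²x ≤ 1`),
`dirL1_gaugeDir_le_of_correction` (`dirL1 ≤ √(d(NM)^d)·√(card n·4M²·V)` — (R4)), `sum_norm_curl_gaugeDir_le_of_correction` (`Σ_{perWin}‖curl‖ ≤ 2x·card(Plane)·√((NM)^d)·√(card n·16M⁴V)` — (R3)).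

WHAT THIS DOES NOT GIVE (honest; F5): the SUP of the correction and its window sup-curl — [Balaban1985BackgroundPropagators] (3.42)∕(3.48) TYPE.

HONEST FRAMING.  ℓ²-bookkeeping over landed lemmas on OUR objects; nothing about Bałaban's minimisers; the chart supplier's sup letters, (P♮), (RES♯), the covariant root and **NE3
are NOT proved**; spine PROVED 0∕9; finite T⁴ rung (B)+1 — NOT infinite volume, NOT mass gap, NOT `BetaPertH`, NOT Clay.  PLACEMENT: `Summits/QuantumFields/BalabanUV/T4Continuum/Spine/NE3/`;
imports accepted modules only; moves nothing.  HONEST DEPENDENCY: continuum YM on T⁴ ⇐ BetaPertH ∧ nine spine estimates (0/9 proved); BetaPertH ⇐ (D1) ∧ (D4) ∧ CAP+tail; G-an2-4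
gates asym, D1 and NE2/3/4.
-/

set_option autoImplicit false

open scoped BigOperators Matrix Matrix.Norms.L2Operator
open NormedSpace Finset

namespace Summit.QuantumFields.BalabanUV.T4Continuum.NE3.LandauCorrectionLettersB8

open Literature.MathematicalPhysics.QuantumFieldTheory.Balaban1983to89
open B7Prop1Explicit B7Prop2Explicit MatrixNorms
open T4AveragingDeficitWall (Ad IsUnitaryCfg IsSkewDir SmallField curl curlAt curlSq dirSq dirL1)
open T4AveragingDeficitWallBoundary (IsPeriodicCfg periodBox mem_periodBox card_periodBox)
open AveragingDeficitPeriodicCounting (IsPeriodicDir)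
open AveragingDeficitTwoLevelPrep (prop1Radius)
open AveragingDeficitMultiLevelPrep (LevelSmall)
open BlockAveragePushDirGauge (gaugeDir)
open MinimalActionLevels (perWin)
open NE3CovariantWeitzenbock (covDiv)
open NE3CovariantBlockMean (bmeanIterW)
open NE3CornerGaugePoincare (sum_nhsNormSq_le_four_mul_of_bmeanIterW_eq_zero)
open NE3CurlOfGaugeDir (norm_curlAt_gaugeDir_le curlSq_gaugeDir_le)
open NE3CurlPairedResidualEnd (dirL1_le_sqrt_mul_sqrt_dirSq)
open SpreadLift (loopRad)
open NE3.PairLandauB8 (avgKernelGauges mem_avgKernelGauges_iff IsLandauB8)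
open NE3.LandauProjectionB8 (sum_nhsNormSq_gaugeDir_le_of_isLandauB8)

noncomputable section

variable {d : ℕ} {n : Type*} [Fintype n] [DecidableEq n]

section Letters

variable [Nonempty n] {L N : ℕ} (hL : 2 ≤ L) (hN : 1 ≤ N) (j : ℕ) {W : Site d → Fin d → (Matrix n n ℂ)ˣ} {x : ℝ}
  (hWu : IsUnitaryCfg W) (hWP : IsPeriodicCfg W ((N * L ^ (j + 1) : ℕ) : ℤ)) (hx : 0 ≤ x) (hs : LevelSmall d L j x) (hWx : SmallField W x)
  (hPs : 8 * d * (((L : ℝ) ^ (j + 1)) * (((d : ℝ) - 1) * (((L : ℝ) ^ (j + 1)) - 1) * x)) ^ 2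
    + 2 * (Fintype.card n * (4 * (d : ℝ) ^ 2 * ((L : ℝ) ^ (j + 1) - 1) ^ 2 * x + 16 * d * loopRad d L ((prop1Radius d L)^[j] x)) ^ 2)
      ≤ 1 / 2)
  {Y : Site d → Fin d → Matrix n n ℂ} (hY : IsPeriodicDir Y ((N * L ^ (j + 1) : ℕ) : ℤ))
  {lam : Site d → Matrix n n ℂ} (hlam : lam ∈ avgKernelGauges (d := d) (n := n) L N (j + 1) W)
  (hLan : IsLandauB8 (d := d) L N (j + 1) W (fun y κ => Y y κ + gaugeDir W lam y κ))

include hL hN hWu hWP hx hs hWx hPs hY hlam hLan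

/-- **(R1) OF THE CORRECTION**: `dirSq (gaugeDir W λ) (periodBox (N·M)) ≤ card n·4M²·Σ_y nhsNormSq (covDiv_W Y y)` (op-norm² `≤ card n`·nhs², then γ3's ℓ²-letter). [folklore] -/
theorem sum_normSq_gaugeDir_le :
    dirSq (gaugeDir W lam) (periodBox (d := d) (N * L ^ (j + 1)))
      ≤ Fintype.card n * (4 * ((L : ℝ) ^ (j + 1)) ^ 2 * ∑ y ∈ periodBox (d := d) (N * L ^ (j + 1)), nhsNormSq (covDiv W Y y)) := by
  have h := sum_nhsNormSq_gaugeDir_le_of_isLandauB8 hL hN j hWu hWP hx hs hWx hPs hY hlam hLan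
  unfold dirSq
  calc ∑ y ∈ periodBox (d := d) (N * L ^ (j + 1)), ∑ κ : Fin d, ‖gaugeDir W lam y κ‖ ^ 2
      ≤ ∑ y ∈ periodBox (d := d) (N * L ^ (j + 1)), ∑ κ : Fin d, Fintype.card n * nhsNormSq (gaugeDir W lam y κ) :=
        Finset.sum_le_sum fun y _ => Finset.sum_le_sum fun κ _ => opNorm_sq_le_card_mul_nhsNormSq _
    _ = Fintype.card n * ∑ y ∈ periodBox (d := d) (N * L ^ (j + 1)), ∑ κ : Fin d, nhsNormSq (gaugeDir W lam y κ) := by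
        rw [Finset.mul_sum]; exact Finset.sum_congr rfl fun y _ => by rw [Finset.mul_sum]
    _ ≤ _ := mul_le_mul_of_nonneg_left h (Nat.cast_nonneg _)

/-- **THE GENERATOR ITSELF**: `Σ_y ‖λ y‖² ≤ card n·16M⁴·Σ_y nhsNormSq (covDiv_W Y y)` (K6-Ξ Poincaré on `N(Q′(W))`, then (R1)). [folklore] -/
theorem sum_normSq_le_of_correction :
    ∑ y ∈ periodBox (d := d) (N * L ^ (j + 1)), ‖lam y‖ ^ 2
      ≤ Fintype.card n * (16 * ((L : ℝ) ^ (j + 1)) ^ 4 * ∑ y ∈ periodBox (d := d) (N * L ^ (j + 1)), nhsNormSq (covDiv W Y y)) := by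
  obtain ⟨hls, hlP, hl0⟩ := mem_avgKernelGauges_iff.mp hlam
  have hG := sum_nhsNormSq_gaugeDir_le_of_isLandauB8 hL hN j hWu hWP hx hs hWx hPs hY hlam hLan
  have hξ : ∀ z ∈ periodBox (d := d) N, bmeanIterW L (j + 1) W lam z = 0 := fun z _ => by simp only [hl0, Pi.zero_apply]
  have hP := sum_nhsNormSq_le_four_mul_of_bmeanIterW_eq_zero hL j hWu hx hs hWx N lam hξ hPs
  rw [Nat.mul_comm] at hP
  calc ∑ y ∈ periodBox (d := d) (N * L ^ (j + 1)), ‖lam y‖ ^ 2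
      ≤ ∑ y ∈ periodBox (d := d) (N * L ^ (j + 1)), Fintype.card n * nhsNormSq (lam y) := Finset.sum_le_sum fun y _ => opNorm_sq_le_card_mul_nhsNormSq _
    _ = Fintype.card n * ∑ y ∈ periodBox (d := d) (N * L ^ (j + 1)), nhsNormSq (lam y) := by rw [Finset.mul_sum]
    _ ≤ Fintype.card n * (4 * (((L : ℝ) ^ (j + 1)) ^ 2 * (4 * ((L : ℝ) ^ (j + 1)) ^ 2 * ∑ y ∈ periodBox (d := d) (N * L ^ (j + 1)), nhsNormSq (covDiv W Y y)))) :=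
        mul_le_mul_of_nonneg_left (hP.trans (mul_le_mul_of_nonneg_left (mul_le_mul_of_nonneg_left hG (by positivity)) (by norm_num))) (Nat.cast_nonneg _)
    _ = _ := by ring

/-- **(R2) OF THE CORRECTION**: `curlSq W (gaugeDir W λ) (periodBox (N·M)) ≤ 4x²·card(Plane d)·card n·16M⁴·Σ_y nhsNormSq (covDiv_W Y y)` — of order `V` in the regime `M²x ≤ 1`
(the curl of a pure-gauge direction is the commutator with the plaquette variable, `NE3CurlOfGaugeDir`). [folklore] -/
theorem curlSq_gaugeDir_le_of_correction :
    curlSq W (gaugeDir W lam) (periodBox (d := d) (N * L ^ (j + 1)))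
      ≤ 4 * x ^ 2 * Fintype.card (T4AveragingDeficitWall.Plane d)
          * (Fintype.card n * (16 * ((L : ℝ) ^ (j + 1)) ^ 4 * ∑ y ∈ periodBox (d := d) (N * L ^ (j + 1)), nhsNormSq (covDiv W Y y))) := by
  have h1 := curlSq_gaugeDir_le hWu hWx lam (periodBox (d := d) (N * L ^ (j + 1)))
  have h2 := sum_normSq_le_of_correction hL hN j hWu hWP hx hs hWx hPs hY hlam hLan
  exact h1.trans (mul_le_mul_of_nonneg_left h2 (by positivity))

/-- **(R4) OF THE CORRECTION**: `dirL1 (gaugeDir W λ) (periodBox (N·M)) ≤ √(d·(N·M)^d)·√(card n·4M²·Σ_y nhsNormSq (covDiv_W Y y))` (Cauchy–Schwarz over the torus). [folklore] -/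
theorem dirL1_gaugeDir_le_of_correction :
    dirL1 (gaugeDir W lam) (periodBox (d := d) (N * L ^ (j + 1)))
      ≤ Real.sqrt ((d : ℝ) * (((N * L ^ (j + 1) : ℕ) : ℝ)) ^ d)
          * Real.sqrt (Fintype.card n * (4 * ((L : ℝ) ^ (j + 1)) ^ 2 * ∑ y ∈ periodBox (d := d) (N * L ^ (j + 1)), nhsNormSq (covDiv W Y y))) := by
  have h1 := dirL1_le_sqrt_mul_sqrt_dirSq (N * L ^ (j + 1)) (gaugeDir W lam)
  have h2 := sum_normSq_gaugeDir_le hL hN j hWu hWP hx hs hWx hPs hY hlam hLan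
  exact h1.trans (mul_le_mul_of_nonneg_left (Real.sqrt_le_sqrt h2) (Real.sqrt_nonneg _))

/-- **(R3) OF THE CORRECTION**: `Σ_{p ∈ perWin d (N·M)} ‖curl W (gaugeDir W λ) p‖ ≤ 2x·card(Plane d)·√((N·M)^d)·√(card n·16M⁴·Σ_y nhsNormSq (covDiv_W Y y))`
(pointwise `2x‖λ(p.1)‖`, then Cauchy–Schwarz over the sites). [folklore] -/
theorem sum_norm_curl_gaugeDir_le_of_correction :
    ∑ p ∈ perWin d (N * L ^ (j + 1)), ‖curl W (gaugeDir W lam) p‖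
      ≤ 2 * x * Fintype.card (T4AveragingDeficitWall.Plane d) * (Real.sqrt ((((N * L ^ (j + 1) : ℕ) : ℝ)) ^ d)
          * Real.sqrt (Fintype.card n * (16 * ((L : ℝ) ^ (j + 1)) ^ 4 * ∑ y ∈ periodBox (d := d) (N * L ^ (j + 1)), nhsNormSq (covDiv W Y y)))) := by
  set P : ℕ := N * L ^ (j + 1) with hPdef
  set S : ℝ := ∑ y ∈ periodBox (d := d) P, ‖lam y‖ with hS
  -- pointwise and the plane count
  have hpt : ∀ (y : Site d) (π : T4AveragingDeficitWall.Plane d), ‖curl W (gaugeDir W lam) (y, π)‖ ≤ 2 * x * ‖lam y‖ :=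
    fun y π => norm_curlAt_gaugeDir_le hWu hWx lam y (ne_of_lt π.2)
  have hsum : ∑ p ∈ perWin d P, ‖curl W (gaugeDir W lam) p‖ ≤ 2 * x * Fintype.card (T4AveragingDeficitWall.Plane d) * S := by
    unfold perWin
    rw [Finset.sum_product]
    calc ∑ y ∈ periodBox (d := d) P, ∑ π : T4AveragingDeficitWall.Plane d, ‖curl W (gaugeDir W lam) (y, π)‖
        ≤ ∑ y ∈ periodBox (d := d) P, ∑ _π : T4AveragingDeficitWall.Plane d, 2 * x * ‖lam y‖ :=
          Finset.sum_le_sum fun y _ => Finset.sum_le_sum fun π _ => hpt y π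
      _ = 2 * x * Fintype.card (T4AveragingDeficitWall.Plane d) * S := by
          simp only [Finset.sum_const, Finset.card_univ, nsmul_eq_mul, hS, Finset.mul_sum]
          exact Finset.sum_congr rfl fun y _ => by ring
  -- Cauchy–Schwarz over the sites: `S ≤ √(P^d)·√(Σ‖λ‖²)`
  have hCS : S ≤ Real.sqrt (((P : ℕ) : ℝ) ^ d) * Real.sqrt (∑ y ∈ periodBox (d := d) P, ‖lam y‖ ^ 2) := by
    have h := Real.sum_mul_le_sqrt_mul_sqrt (periodBox (d := d) P) (fun _ => (1 : ℝ)) (fun y => ‖lam y‖)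
    have h1 : ∑ y ∈ periodBox (d := d) P, (1 : ℝ) * ‖lam y‖ = S := by rw [hS]; exact Finset.sum_congr rfl fun y _ => one_mul _
    have h2 : ∑ y ∈ periodBox (d := d) P, (1 : ℝ) ^ 2 = ((P : ℕ) : ℝ) ^ d := by
      rw [Finset.sum_const, card_periodBox, nsmul_eq_mul, one_pow, mul_one, Nat.cast_pow]
    rw [h1, h2] at h
    exact h
  have h2 := sum_normSq_le_of_correction hL hN j hWu hWP hx hs hWx hPs hY hlam hLan
  have hx2 : 0 ≤ 2 * x * Fintype.card (T4AveragingDeficitWall.Plane d) := by positivity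
  calc ∑ p ∈ perWin d P, ‖curl W (gaugeDir W lam) p‖ ≤ 2 * x * Fintype.card (T4AveragingDeficitWall.Plane d) * S := hsum
    _ ≤ 2 * x * Fintype.card (T4AveragingDeficitWall.Plane d)
          * (Real.sqrt (((P : ℕ) : ℝ) ^ d) * Real.sqrt (∑ y ∈ periodBox (d := d) P, ‖lam y‖ ^ 2)) := mul_le_mul_of_nonneg_left hCS hx2
    _ ≤ 2 * x * Fintype.card (T4AveragingDeficitWall.Plane d) * (Real.sqrt (((P : ℕ) : ℝ) ^ d)
          * Real.sqrt (Fintype.card n * (16 * ((L : ℝ) ^ (j + 1)) ^ 4 * ∑ y ∈ periodBox (d := d) P, nhsNormSq (covDiv W Y y)))) :=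
        mul_le_mul_of_nonneg_left (mul_le_mul_of_nonneg_left (Real.sqrt_le_sqrt h2) (Real.sqrt_nonneg _)) hx2

end Letters

end

end Summit.QuantumFields.BalabanUV.T4Continuum.NE3.LandauCorrectionLettersB8
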